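import Mathlib.Analysis.SpecialFunctions.Pow.Real
import Mathlib.Analysis.SpecialFunctions.Log.Basic
import HarnessLib

/-!
# Lemarié-Rieusset 2016, §13.9, Step 2: the reduced estimates (13.38)–(13.39) (real algebra)

Analysis/FluidPDE file in the decomposition of the named fact
`Literature.Analysis.FluidPDE.lemarieRieusset_ckn_criterion` (Lemarié-Rieusset 2016, Thm. 13.8),
towards `LemarieRieusset2016.lemma13_4` from Lemma 13.3: the passage (p. 471) from the local
estimates (13.30)–(13.31) for `U_r, V_r, P_r` to the estimates (13.38)–(13.39) for the *reduced
quantities* `α_r = r^{-(3 - 10/τ₂)} (U_r + V_r)`, `p_r = r^{-5(1 - 2q₀/τ₂)} P_r`, `β_r = r⁻¹ V_r`,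
with the force bound `F_ρ ≤ ‖1_{Q₀} f‖ ρ^{5(1 - 10/(7τ₀))}` ((13.36)). This is bookkeeping of
powers of `r` and `ρ` between nonnegative real numbers, **proved** here once and for all
(`LemarieRieusset2016.reduced_estimates`); the second term of (13.39) carries the exponent
`ρ^{5q₀/τ₂ - q₀}` of the corrected second printing (footnote 1, p. 472).

## References

* P. G. Lemarié-Rieusset, *The Navier–Stokes Problem in the 21st Century*, CRC Press (2016),
  §13.9, (13.36)–(13.39), pp. 471–472. [LemarieRieusset2016]
-/

namespace Literature.Analysis.FluidPDE

namespace LemarieRieusset2016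

/-- **(13.30)–(13.31) ⟹ (13.38)–(13.39)** (Lemarié-Rieusset 2016, p. 471–472). Let `q₀ > 0`,
`τ₀, τ₂ > 0`, `0 < r ≤ ρ`, nonnegative reals `U_r, V_r, P_r` (scale `r`) and `U, V, P, F`
(scale `ρ`) with
`U_r + V_r ≤ C ((r/ρ)³ U + (ρ^{1/2}/r)(U + V) V^{1/2} + r⁻¹ ρ^{2 + 3/2 - 5/q₀} P^{1/q₀} U^{1/2}
  + (U + V)^{1/2} F^{7/10})`, `P_r ≤ C ((r/ρ)³ P + r^{5(1 - 2q₀/3)} ρ^{q₀/3} U^{q₀/2} V^{q₀/2})` and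
`F ≤ M ρ^{5(1 - 10/(7τ₀))}`. Then, with `a = 3 - 10/τ₂`, `b = 5(1 - 2q₀/τ₂)`,
`α_ρ = (U + V)/ρ^a`, `β_ρ = V/ρ`, `p_ρ = P/ρ^b`:
`(U_r + V_r)/r^a ≤ C ((r/ρ)^{10/τ₂} α_ρ + (ρ/r)^{a+1} α_ρ β_ρ^{1/2}
  + (ρ/r)^{a+1} ρ^{1 - 5/τ₂} p_ρ^{1/q₀} α_ρ^{1/2} + (ρ/r)^a ρ^{2 - 5/τ₀ + 5/τ₂} M^{7/10} α_ρ^{1/2})`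
(13.38) and
`P_r/r^b ≤ C ((r/ρ)^{10q₀/τ₂ - 2} p_ρ + (ρ/r)^{5q₀(2/3 - 2/τ₂)} ρ^{5q₀/τ₂ - q₀} α_ρ^{q₀/2} β_ρ^{q₀/2})`
(13.39). [cite: LemarieRieusset2016, (13.38)–(13.39) pp. 471–472] -/
theorem reduced_estimates {C M q₀ τ₀ τ₂ r ρ Ur Vr Pr U V P F : ℝ} (hC : 0 ≤ C) (hM : 0 ≤ M)
    (hq₀ : 0 < q₀) (hτ₀ : 0 < τ₀) (hτ₂ : 0 < τ₂) (hr : 0 < r) (hρ : 0 < ρ)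
    (hU : 0 ≤ U) (hV : 0 ≤ V) (hP : 0 ≤ P) (hF : 0 ≤ F)
    (h30 : Ur + Vr ≤ C * ((r / ρ) ^ 3 * U + ρ ^ (1 / 2 : ℝ) / r * (U + V) * V ^ (1 / 2 : ℝ) +
      r⁻¹ * ρ ^ (2 + 3 / 2 - 5 / q₀) * P ^ (1 / q₀) * U ^ (1 / 2 : ℝ) +
      (U + V) ^ (1 / 2 : ℝ) * F ^ (7 / 10 : ℝ)))
    (h31 : Pr ≤ C * ((r / ρ) ^ 3 * P +
      r ^ (5 * (1 - 2 * q₀ / 3)) * ρ ^ (q₀ / 3) * U ^ (q₀ / 2) * V ^ (q₀ / 2)))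
    (hFM : F ≤ M * ρ ^ (5 * (1 - 10 / 7 / τ₀))) :
    (Ur + Vr) / r ^ (3 - 10 / τ₂) ≤
      C * ((r / ρ) ^ (10 / τ₂) * ((U + V) / ρ ^ (3 - 10 / τ₂)) +
        (ρ / r) ^ (3 - 10 / τ₂ + 1) * ((U + V) / ρ ^ (3 - 10 / τ₂)) * (V / ρ) ^ (1 / 2 : ℝ) +
        (ρ / r) ^ (3 - 10 / τ₂ + 1) * ρ ^ (1 - 5 / τ₂) * (P / ρ ^ (5 * (1 - 2 * q₀ / τ₂))) ^ (1 / q₀) *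
          ((U + V) / ρ ^ (3 - 10 / τ₂)) ^ (1 / 2 : ℝ) +
        (ρ / r) ^ (3 - 10 / τ₂) * ρ ^ (2 - 5 / τ₀ + 5 / τ₂) * M ^ (7 / 10 : ℝ) *
          ((U + V) / ρ ^ (3 - 10 / τ₂)) ^ (1 / 2 : ℝ)) ∧
    Pr / r ^ (5 * (1 - 2 * q₀ / τ₂)) ≤
      C * ((r / ρ) ^ (10 * q₀ / τ₂ - 2) * (P / ρ ^ (5 * (1 - 2 * q₀ / τ₂))) +
        (ρ / r) ^ (5 * q₀ * (2 / 3 - 2 / τ₂)) * ρ ^ (5 * q₀ / τ₂ - q₀) *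
          ((U + V) / ρ ^ (3 - 10 / τ₂)) ^ (q₀ / 2) * (V / ρ) ^ (q₀ / 2)) := by
  -- abbreviations for the exponents
  set a : ℝ := 3 - 10 / τ₂ with ha
  set b : ℝ := 5 * (1 - 2 * q₀ / τ₂) with hb
  have hra : 0 < r ^ a := Real.rpow_pos_of_pos hr a
  have hrb : 0 < r ^ b := Real.rpow_pos_of_pos hr b
  have hρa : 0 < ρ ^ a := Real.rpow_pos_of_pos hρ a
  have hρb : 0 < ρ ^ b := Real.rpow_pos_of_pos hρ b
  have hUV : 0 ≤ U + V := add_nonneg hU hV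
  -- `log`-coordinates: every coefficient is `exp (x log r + y log ρ)`
  have key : ∀ {X Y : ℝ}, X = Y → Real.exp X = Real.exp Y := fun h => by rw [h]
  -- the monomial identities behind the four terms of (13.38)
  have c1 : (r / ρ) ^ (3 : ℕ) / r ^ a = (r / ρ) ^ (10 / τ₂) / ρ ^ a := by
    rw [← Real.exp_log hr, ← Real.exp_log hρ]
    simp only [← Real.exp_mul, ← Real.exp_nat_mul, ← Real.exp_add, div_eq_mul_inv, ← Real.exp_neg]
    exact key (by rw [ha]; push_cast; ring)
  have c2 : ρ ^ (1 / 2 : ℝ) / r / r ^ a =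
      (ρ / r) ^ (a + 1) / ρ ^ a / ρ ^ (1 / 2 : ℝ) := by
    rw [← Real.exp_log hr, ← Real.exp_log hρ]
    simp only [← Real.exp_mul, ← Real.exp_add, div_eq_mul_inv, ← Real.exp_neg]
    exact key (by ring)
  have c3 : r⁻¹ * ρ ^ (2 + 3 / 2 - 5 / q₀) / r ^ a =
      (ρ / r) ^ (a + 1) * ρ ^ (1 - 5 / τ₂) / (ρ ^ b) ^ (1 / q₀) / (ρ ^ a) ^ (1 / 2 : ℝ) := by
    rw [← Real.exp_log hr, ← Real.exp_log hρ]
    simp only [← Real.exp_mul, ← Real.exp_add, div_eq_mul_inv, ← Real.exp_neg]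
    exact key (by rw [ha, hb]; field_simp; ring)
  have c4 : (ρ ^ (5 * (1 - 10 / 7 / τ₀))) ^ (7 / 10 : ℝ) / r ^ a =
      (ρ / r) ^ a * ρ ^ (2 - 5 / τ₀ + 5 / τ₂) / (ρ ^ a) ^ (1 / 2 : ℝ) := by
    rw [← Real.exp_log hr, ← Real.exp_log hρ]
    simp only [← Real.exp_mul, ← Real.exp_add, div_eq_mul_inv, ← Real.exp_neg]
    exact key (by rw [ha]; field_simp; ring)
  -- the monomial identities behind the two terms of (13.39)
  have c5 : (r / ρ) ^ (3 : ℕ) / r ^ b = (r / ρ) ^ (10 * q₀ / τ₂ - 2) / ρ ^ b := by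
    rw [← Real.exp_log hr, ← Real.exp_log hρ]
    simp only [← Real.exp_mul, ← Real.exp_nat_mul, ← Real.exp_add, div_eq_mul_inv, ← Real.exp_neg]
    exact key (by rw [hb]; push_cast; field_simp; ring)
  have c6 : r ^ (5 * (1 - 2 * q₀ / 3)) * ρ ^ (q₀ / 3) / r ^ b =
      (ρ / r) ^ (5 * q₀ * (2 / 3 - 2 / τ₂)) * ρ ^ (5 * q₀ / τ₂ - q₀) / (ρ ^ a) ^ (q₀ / 2) /
        ρ ^ (q₀ / 2) := by
    rw [← Real.exp_log hr, ← Real.exp_log hρ]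
    simp only [← Real.exp_mul, ← Real.exp_add, div_eq_mul_inv, ← Real.exp_neg]
    exact key (by rw [ha, hb]; field_simp; ring)
  constructor
  · -- (13.38)
    rw [div_le_iff₀ hra]
    refine h30.trans ?_
    rw [mul_assoc C]
    refine mul_le_mul_of_nonneg_left ?_ hC
    rw [add_mul, add_mul, add_mul]
    gcongr ?_ + ?_ + ?_ + ?_
    · -- first term: `(r/ρ)³ U ≤ (r/ρ)^{10/τ₂} α_ρ r^a`, using `U ≤ U + V`
      have h1 : (r / ρ) ^ (3 : ℕ) * U = (r / ρ) ^ (10 / τ₂) * (U / ρ ^ a) * r ^ a := by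
        have := c1
        field_simp at this ⊢
        linear_combination U * this
      rw [h1]
      gcongr
      linarith
    · -- second term: equality
      have h2 : ρ ^ (1 / 2 : ℝ) / r * (U + V) * V ^ (1 / 2 : ℝ) =
          (ρ / r) ^ (a + 1) * ((U + V) / ρ ^ a) * (V / ρ) ^ (1 / 2 : ℝ) * r ^ a := by
        rw [Real.div_rpow hV hρ.le]
        have hρh : 0 < ρ ^ (1 / 2 : ℝ) := Real.rpow_pos_of_pos hρ _
        have := c2
        field_simp at this ⊢
        linear_combination (U + V) * V ^ (1 / 2 : ℝ) * this
      rw [h2]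
    · -- third term: `U^{1/2} ≤ (U + V)^{1/2}`
      have h3 : r⁻¹ * ρ ^ (2 + 3 / 2 - 5 / q₀) * P ^ (1 / q₀) * (U + V) ^ (1 / 2 : ℝ) =
          (ρ / r) ^ (a + 1) * ρ ^ (1 - 5 / τ₂) * (P / ρ ^ b) ^ (1 / q₀) *
            ((U + V) / ρ ^ a) ^ (1 / 2 : ℝ) * r ^ a := by
        rw [Real.div_rpow hP hρb.le, Real.div_rpow hUV hρa.le]
        have h' : 0 < (ρ ^ b) ^ (1 / q₀) := Real.rpow_pos_of_pos hρb _
        have h'' : 0 < (ρ ^ a) ^ (1 / 2 : ℝ) := Real.rpow_pos_of_pos hρa _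
        have := c3
        field_simp at this ⊢
        linear_combination P ^ (1 / q₀) * (U + V) ^ (1 / 2 : ℝ) * this
      calc r⁻¹ * ρ ^ (2 + 3 / 2 - 5 / q₀) * P ^ (1 / q₀) * U ^ (1 / 2 : ℝ)
          ≤ r⁻¹ * ρ ^ (2 + 3 / 2 - 5 / q₀) * P ^ (1 / q₀) * (U + V) ^ (1 / 2 : ℝ) := by
            gcongr
            linarith
        _ = _ := h3
    · -- fourth term: the force, `F^{7/10} ≤ M^{7/10} ρ^{(7/2)(1 - 10/(7τ₀))}`
      have hF' : F ^ (7 / 10 : ℝ) ≤ M ^ (7 / 10 : ℝ) * (ρ ^ (5 * (1 - 10 / 7 / τ₀))) ^ (7 / 10 : ℝ) := by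
        rw [← Real.mul_rpow hM (Real.rpow_nonneg hρ.le _)]
        exact Real.rpow_le_rpow hF hFM (by norm_num)
      have h4 : (U + V) ^ (1 / 2 : ℝ) * (M ^ (7 / 10 : ℝ) * (ρ ^ (5 * (1 - 10 / 7 / τ₀))) ^ (7 / 10 : ℝ)) =
          (ρ / r) ^ a * ρ ^ (2 - 5 / τ₀ + 5 / τ₂) * M ^ (7 / 10 : ℝ) *
            ((U + V) / ρ ^ a) ^ (1 / 2 : ℝ) * r ^ a := by
        rw [Real.div_rpow hUV hρa.le]
        have h'' : 0 < (ρ ^ a) ^ (1 / 2 : ℝ) := Real.rpow_pos_of_pos hρa _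
        have := c4
        field_simp at this ⊢
        linear_combination (U + V) ^ (1 / 2 : ℝ) * M ^ (7 / 10 : ℝ) * this
      calc (U + V) ^ (1 / 2 : ℝ) * F ^ (7 / 10 : ℝ)
          ≤ (U + V) ^ (1 / 2 : ℝ) * (M ^ (7 / 10 : ℝ) * (ρ ^ (5 * (1 - 10 / 7 / τ₀))) ^ (7 / 10 : ℝ)) :=
            mul_le_mul_of_nonneg_left hF' (Real.rpow_nonneg hUV _)
        _ = _ := h4
  · -- (13.39)
    rw [div_le_iff₀ hrb]
    refine h31.trans ?_
    rw [mul_assoc C]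
    refine mul_le_mul_of_nonneg_left ?_ hC
    rw [add_mul]
    gcongr ?_ + ?_
    · have h5 : (r / ρ) ^ (3 : ℕ) * P = (r / ρ) ^ (10 * q₀ / τ₂ - 2) * (P / ρ ^ b) * r ^ b := by
        have := c5
        field_simp at this ⊢
        linear_combination P * this
      rw [h5]
    · have h6 : r ^ (5 * (1 - 2 * q₀ / 3)) * ρ ^ (q₀ / 3) * (U + V) ^ (q₀ / 2) * V ^ (q₀ / 2) =
          (ρ / r) ^ (5 * q₀ * (2 / 3 - 2 / τ₂)) * ρ ^ (5 * q₀ / τ₂ - q₀) *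
            ((U + V) / ρ ^ a) ^ (q₀ / 2) * (V / ρ) ^ (q₀ / 2) * r ^ b := by
        rw [Real.div_rpow hUV hρa.le, Real.div_rpow hV hρ.le]
        have h' : 0 < (ρ ^ a) ^ (q₀ / 2) := Real.rpow_pos_of_pos hρa _
        have h'' : 0 < ρ ^ (q₀ / 2) := Real.rpow_pos_of_pos hρ _
        have := c6
        field_simp at this ⊢
        linear_combination (U + V) ^ (q₀ / 2) * V ^ (q₀ / 2) * this
      calc r ^ (5 * (1 - 2 * q₀ / 3)) * ρ ^ (q₀ / 3) * U ^ (q₀ / 2) * V ^ (q₀ / 2)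
          ≤ r ^ (5 * (1 - 2 * q₀ / 3)) * ρ ^ (q₀ / 3) * (U + V) ^ (q₀ / 2) * V ^ (q₀ / 2) := by
            gcongr
            linarith
        _ = _ := h6

end LemarieRieusset2016

end Literature.Analysis.FluidPDE
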